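import Summits.QuantumFields.BalabanUV.Beta.GAN24.BornLambdaVertexTent
import Summits.QuantumFields.BalabanUV.Beta.GAN24.ContactTentRefine

/-!
# `BalabanUV.Beta.GAN24.BornLambdaBracketLetter` — binder row G-an2-4 ∕ (CONV-C), CT-ROUTE, the row owner's `gen20/BORNSEC-PLAN-v1.md` (v1.1) §0 (c1) ∕
# §A (Λ-C)(C2) AS A LETTER WITH THE POWER DISPLAYED (gan24-refuter PRICING-GAN24 v3.16 Q21 residual «the display of C, κ of the (C2) letter on the cell,
# (k−i)-uniform»): **THE BRACKET OF THE DRESSED CHAIN AGAINST THE BORN Λ-COEFFICIENTS OF ITS BIRTH LEVEL IS `(−cΛ)·(Lc^i)^{2(d+1)}` TIMES THE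
# `Lc^{k−1−i}`-CONTOUR TENT OF THE LEVEL-`k` MULTIPLIER COLUMN, HENCE `≤ |cΛ|·C_K·e^{δ_K}·(Lc^{k−1−i})^{−(2d+1)}·e^{−δ_K‖quo (Lc^{k−1−i}) y − u′‖∞}` WITH THE
# K-SLOT's `(k, i)`-UNIFORM CONSTANTS** — `d = 3`, `Lc ≥ 2`: unconditional

NOT IN PRINT; OUR PROOF ATTEMPT (unit `b2b-balaban-gan24-p2`, gen 33 = prover-b2b-balaban-gan24-p2-g33-0, road-P2 chair of row G-an2-4; CRUX TEAM (2), 2026-08-21; INTENT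
«BORN-Λ-BRACKET-LETTER» journal `CLAIMS.log` l.34096; OWNER gan24-p1-g21 GO (W2) l.34168).  HONEST FRAMING (cell contract, verbatim): «discharging `BetaPertH` makes Bałaban's UV
stability UNCONDITIONAL — a real constructive-QFT result; it is NOT the continuum limit and NOT the Clay problem.»  HONEST DEPENDENCY (verbatim): «continuum YM on T⁴ ⇐ BetaPertH
∧ nine spine estimates (0/9 proved); BetaPertH ⇐ (D1) ∧ (D4) ∧ CAP+tail; G-an2-4 gates asym, D1 and NE2/3/4.»  ABSOLUTE RULE: nothing printed is a hypothesis; no `def … : Prop`,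
no `sorry`, 0 `def`; [folklore] bookkeeping BY NAME over the OWNER's `BornLambdaTent` (p291405) ∕ `BornLambdaVertexTent` (p292620), road S3's `TaylorLamBracket`, MY
`ContactTentCauchy.abs_unitTent_le` (p289648) ∕ `ContactTentRefine.abs_contourSumAdj_le_centre` (p291741), road P1's `FibreStrip.unitDecayK_holds` (`d = 3`).

## The object (generic `d`; in-block root `ρ = toSite rr`; birth level `i`, observation level `k > i`)
The Λ one-gauge cells of leaf-01 g59's `BornLambdaContactCells.contact_bornLam_zero∕succ_eq_cells_three`, factorised by leaf-02 g48's
`ContactLambdaCellFactorised.contact_lambda_eq_factorised`, carry per coarse bond `(μ, y)` the BRACKET `⟨T_i(κ′u′; ·), c_i(μ,y; ·)⟩ = Σ'_u Σ_κ T_i κ′ u′ κ u · c_i μ y κ u` of the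
dressed chain `T_i = legChain (respStepBmSeq ρ Lc) i (k−1−i)` against the born Λ-coefficient family of member `i`: `c_0 = cΛ·lamCoeffOf (KInv Lc) Lc`,
`c_{j+1} = (cΛ·Lc^{2(d+1)})·lamCoeffK (KStepUnit Lc (j+1)) ((smStep d Lc j)²•E2 d Lc (j+1)) Lc` — the «vertex factor `V_i`» of the plan.
## Content (0 sorry, 0 def)
 * §1 `bornCoeff_zero_eq_tent` ∕ `bornCoeff_succ_eq_tent`: for EVERY member `i`, `c_i μ y κ u = (−cΛ)·((Lc^i)^{2(d+1)}·𝒬ᵀ_{Lc}[wΦ_{Lc^{i+1}}(·; μ; · − y)](κ, u))` (owner's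
   `BornLambdaTent` §2 and road S3's one-shot identity; `wΦ_congrN` bridges `wΦ_{Lc}` and `wΦ_{Lc^{0+1}}`).
 * §2 KERNEL LETTERS from the K-slot's unit decay `hK = UnitDecayK … C δ` (generic `d`): `abs_unitColumn_le`
   `|(Lc^i)^{2(d+1)}·wΦ_{Lc^{i+m+1}} κ l z| ≤ C·((Lc^m)^{2(d+1)})⁻¹·e^{−δ|z|₁}` and the TENT LETTER `abs_unitColumnTent_le`
   `|(Lc^i)^{2(d+1)}·𝒬ᵀ_{Lc^m}[wΦ_{Lc^{i+m+1}}(·, κ′, · − u′)](μ, y)| ≤ C·e^{δ}·((Lc^m)^{2d+1})⁻¹·e^{−δ‖quo (Lc^m) y − u′‖∞}` — the POWER `(Lc^m)^{−(2d+1)}`, `m = k−1−i`.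
 * §3 BRACKET IDENTITIES: one step `bracket_eq_of_one_step` (generic `d`, `k = i+1`: `= (−cΛ)·(Lc^i)^{2(d+1)}·wΦ_{Lc^{i+1}} κ′ μ (u′ − y)`), chain
   `bracket_eq_tent_of_chain_three` (`d = 3`, `k = i+n+2`: `= (−cΛ)·(Lc^i)^8·𝒬ᵀ_{Lc^{n+1}}[wΦ_{Lc^{i+n+2}}(·, κ′, · − u′)](μ, y)`).
 * §4 `d = 3`, `2 ≤ Lc`: **`bracket_letter_three_of_unitDecayK`** (constants THREADED from any `hK = UnitDecayK 3 Lc … C δ`, `0 < δ`: bound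
   `|cΛ|·(C·e^{δ})·((Lc^{k−1−i})^7)⁻¹·e^{−δ‖quo (Lc^{k−1−i}) y − u′‖∞}`) and, UNCONDITIONAL, **`exists_bracket_letter_three`** — `∃ C δ, 0 ≤ C ∧ 0 < δ ∧ ∀ rr ∈ box, ∀ cΛ i k κ′ u′ μ y,
   |⟨T_i(κ′u′;·), (−cΛ)·((Lc^i)^8·𝒬ᵀ_{Lc}[wΦ_{Lc^{i+1}}(·;μ;·−y)])⟩| ≤ |cΛ|·C·((Lc^{k−1−i})^7)⁻¹·e^{−δ‖quo (Lc^{k−1−i}) y − u′‖∞}`; and the two forms LITERALLY on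
   leaf-01's cell coefficients **`exists_bracket_bornLam_zero_letter_three`** (member `0`) ∕ **`exists_bracket_bornLam_succ_letter_three`** (members `j+1`, ONE pair
   `(C, δ)` for all `j, k`).  Constants = `FibreStrip.unitDecayK_holds`' `(Cst·e^{2κ₀}·e^{δ}, δ = κ₀∕(4Lc))`, `(k, i)`-UNIFORM; power `N′^{−7}`, `N′ = Lc^{k−1−i}`.
 * §5 THE CLIMBED PAIRING (multiplier slot of BOTH halves, M-Λ ∕ M-V): **`abs_unitColumn_pair_legChain_le_three`** (constants threaded) ∕
   **`exists_unitColumn_pair_legChain_letter_three`**: `|(Lc^i)^8·Σ'_{y₁}Σ_{κ₁} wΦ_{Lc^{i+1}} κ₁ μ (y₁−y)·legChain (respStepBmSeq ρ Lc) (i+1) n κ′ u′ κ₁ y₁| ≤ C·((Lc^{n+1})^7)⁻¹·e^{−δ‖quo (Lc^{n+1}) y − u′‖∞}`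
   (the OWNER's `tsum_wΦ_shift_mul_legChain_eq_tent_three` + §2) — stated on the bare pairing, design-independent for the V sector.
HONEST.  [folklore]; the (C2) letter ONLY — NOT the commutator factor (C3), NOT the product (C4), NO sum over `(μ, y)` (C5), NO assembly (C6), NOT (Λ-U);
discharges NOTHING of `hB` ∕ (hS, hSall, hSdev) on (E); 0 wall binders; NEVER «G-an2-4 closed»; NOT (CONV-C) as typed, NOT D1, NOT BetaPertH, NOT continuum,
NOT Clay.  Text locations only: [Balaban1987RG1] (1.20)–(1.22) p. 264; [King1986] §4 p. 672.
-/

noncomputable section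

open Finset
open scoped BigOperators
open Literature.MathematicalPhysics.QuantumFieldTheory
open Literature.MathematicalPhysics.QuantumFieldTheory.LatticeForm (quo)
open Literature.MathematicalPhysics.QuantumFieldTheory.Balaban1983to89
open Literature.MathematicalPhysics.QuantumFieldTheory.Balaban1983to89.Beta
open B4ContourShift (supNorm supNorm_nonneg)
open B12Sec2to5 (l1 l1_nonneg)
open AffineAveraging (Form1 Site box toSite)
open AffineReproduction (contourSumAdj)
open KernelSpecInstance (wΦ)
open OneStepResolventKernel (Fib KInv)
open BalabanStepJetsSucc (E2 lamCoeffK)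
open BalabanStepJets (lamCoeffOf)
open ResolventComposition (quo_one)
open Summit.QuantumFields.BalabanUV.Beta.GAN24.CombesThomas (sfStep smStep KStepUnit UnitDecayK)
open Summit.QuantumFields.BalabanUV.Beta.GAN24.Push4Iter (legChain legChain_zero)
open Summit.QuantumFields.BalabanUV.Beta.GAN24.RespStepBmDecompExact (respStepBmSeq)
open Summit.QuantumFields.BalabanUV.Beta.GAN24.RespStepCauchy (supNorm_le_l1)
open Summit.QuantumFields.BalabanUV.Beta.GAN24.FibreStrip (unitDecayK_holds)
open Summit.QuantumFields.BalabanUV.Beta.GAN24.TaylorLamBracket (lamCoeffOf_KInv_eq_neg_contourSumAdj_shift)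
open Summit.QuantumFields.BalabanUV.Beta.GAN24.BornLambdaTent (lamCoeffK_KStepUnit_eq_neg_tent contourSumAdj_const_mul)
open Summit.QuantumFields.BalabanUV.Beta.GAN24.BornLambdaVertexTent (tsum_respStepBmSeq_mul_contourSumAdj tsum_legChain_mul_contourSumAdj
  tsum_wΦ_shift_mul_legChain_eq_tent_three)
open Summit.QuantumFields.BalabanUV.Beta.GAN24.ContactTentCauchy (abs_unitTent_le)
open Summit.QuantumFields.BalabanUV.Beta.GAN24.ContactTentRefine (abs_contourSumAdj_le_centre)

namespace Summit.QuantumFields.BalabanUV.Beta.GAN24.BornLambdaBracketLetter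

variable {d : ℕ} {Lc : ℕ} [NeZero Lc]

/-! ## §1 The born Λ-coefficient families of every member are `(−cΛ)·(Lc^i)^{2(d+1)}·𝒬ᵀ_{Lc}[wΦ_{Lc^{i+1}}]` -/

section Coeff

/-- [folklore] The multiplier kernel depends on the block size only through its value (`NeZero` is a `Prop`): equal sizes, equal kernels. -/
theorem wΦ_congrN {N M : ℕ} [NeZero N] [NeZero M] (h : N = M) (κ l : Fin (d + 1)) (y : Site (d + 1)) :
    wΦ (N := N) (d := d) κ l y = wΦ (N := M) (d := d) κ l y := by
  subst h
  rfl

/-- NOT IN PRINT; OUR BOOKKEEPING ([folklore]).  **MEMBER `0`'s BORN Λ-COEFFICIENTS** (as they stand in leaf-01's `contact_bornLam_zero_eq_cells_three`):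
`cΛ·lamCoeffOf (KInv Lc) Lc μ y κ u = (−cΛ)·((Lc^0)^{2(d+1)}·𝒬ᵀ_{Lc}[wΦ_{Lc^{0+1}}(·; μ; · − y)](κ, u))` — road S3's one-shot identity. -/
theorem bornCoeff_zero_eq_tent (cΛ : ℝ) (μ : Fin (d + 1)) (y : Site (d + 1)) (κ : Fin (d + 1)) (u : Site (d + 1)) :
    cΛ * lamCoeffOf (KInv (N := Lc) (d := d)) Lc μ y κ u
      = (-cΛ) * ((((Lc : ℝ) ^ 0) ^ (2 * (d + 1))) *
          contourSumAdj Lc (fun κ'' q => wΦ (N := Lc ^ (0 + 1)) (d := d) κ'' μ (q - y)) κ u) := by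
  rw [lamCoeffOf_KInv_eq_neg_contourSumAdj_shift]
  have e : (fun κ'' q => wΦ (N := Lc ^ (0 + 1)) (d := d) κ'' μ (q - y)) = fun κ'' q => wΦ (N := Lc) (d := d) κ'' μ (q - y) := by
    funext κ'' q
    exact wΦ_congrN (by rw [zero_add, pow_one]) κ'' μ (q - y)
  rw [e, pow_zero, one_pow, one_mul, mul_neg, neg_mul]

/-- NOT IN PRINT; OUR BOOKKEEPING ([folklore]).  **MEMBER `j+1`'s BORN Λ-COEFFICIENTS** (as they stand in leaf-01's `contact_bornLam_succ_eq_cells_three`):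
`(cΛ·Lc^{2(d+1)})·lamCoeffK (KStepUnit Lc (j+1)) ((smStep d Lc j)²•E2 d Lc (j+1)) Lc μ y κ u = (−cΛ)·((Lc^{j+1})^{2(d+1)}·𝒬ᵀ_{Lc}[wΦ_{Lc^{j+1+1}}(·; μ; · − y)](κ, u))`
— the OWNER's `BornLambdaTent.lamCoeffK_KStepUnit_eq_neg_tent`; the two `Lc^{2(d+1)}` cancel. -/
theorem bornCoeff_succ_eq_tent (cΛ : ℝ) (j : ℕ) (μ : Fin (d + 1)) (y : Site (d + 1)) (κ : Fin (d + 1)) (u : Site (d + 1)) :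
    (cΛ * (Lc : ℝ) ^ (2 * (d + 1))) * lamCoeffK (KStepUnit (d := d) Lc (j + 1)) ((smStep d Lc j) ^ 2 • E2 d Lc (j + 1)) Lc μ y κ u
      = (-cΛ) * ((((Lc : ℝ) ^ (j + 1)) ^ (2 * (d + 1))) *
          contourSumAdj Lc (fun κ'' q => wΦ (N := Lc ^ (j + 1 + 1)) (d := d) κ'' μ (q - y)) κ u) := by
  have hL : (Lc : ℝ) ^ (2 * (d + 1)) ≠ 0 := pow_ne_zero _ (Nat.cast_ne_zero.2 (NeZero.ne Lc))
  rw [lamCoeffK_KStepUnit_eq_neg_tent, contourSumAdj_const_mul]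
  have e : (fun κ'' q => wΦ (N := Lc ^ (j + 1 + 1)) (d := d) κ'' μ (q - y)) = fun κ'' q => wΦ (N := Lc ^ (j + 2)) (d := d) κ'' μ (q - y) := by
    funext κ'' q
    exact wΦ_congrN rfl κ'' μ (q - y)
  rw [e]
  field_simp

end Coeff

/-! ## §2 Kernel letters from the K-slot's unit decay: the unit column read `m` levels up, and its `Lc^m`-contour tent -/

section Kernel

/-- NOT IN PRINT; OUR BOOKKEEPING ([folklore]).  **THE LEVEL-`(i+m+1)` MULTIPLIER COLUMN IN LEVEL-`i` UNITS**: the K-slot's unit decay `hK` gives, for all `i, m`,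
`|(Lc^i)^{2(d+1)}·wΦ_{Lc^{i+m+1}} κ l z| ≤ C·((Lc^m)^{2(d+1)})⁻¹·e^{−δ|z|₁}` (MY `ContactTentCauchy.abs_unitTent_le` at level `i+m`, rescaled by the exact ratio
`(Lc^i)^{2(d+1)}∕(Lc^{i+m+1})^{2(d+1)}`). -/
theorem abs_unitColumn_le {C δ : ℝ} (hK : UnitDecayK d Lc (sfStep Lc) (smStep d Lc) C δ) (hδ : 0 ≤ δ) (i m : ℕ) (κ l : Fin (d + 1))
    (z : Site (d + 1)) :
    |(((Lc : ℝ) ^ i) ^ (2 * (d + 1))) * wΦ (N := Lc ^ (i + m + 1)) (d := d) κ l z|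
      ≤ C * ((((Lc : ℝ) ^ m) ^ (2 * (d + 1)))⁻¹) * Real.exp (-δ * l1 z) := by
  have hL : (0 : ℝ) < (Lc : ℝ) := Nat.cast_pos.2 (Nat.pos_of_ne_zero (NeZero.ne Lc))
  have h := abs_unitTent_le hK hδ (i + m) κ l z
  set A : ℝ := (((Lc : ℝ) ^ (i + m + 1)) ^ (2 * (d + 1))) with hA
  have hA0 : 0 < A := by positivity
  set w : ℝ := wΦ (N := Lc ^ (i + m + 1)) (d := d) κ l z
  have e1 : |(((Lc : ℝ) ^ i) ^ (2 * (d + 1))) * w| = ((((Lc : ℝ) ^ i) ^ (2 * (d + 1))) / A) * |A * w| := by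
    rw [abs_mul, abs_mul, abs_of_nonneg hA0.le, abs_of_nonneg (by positivity : (0 : ℝ) ≤ ((Lc : ℝ) ^ i) ^ (2 * (d + 1)))]
    field_simp
  rw [e1]
  refine (mul_le_mul_of_nonneg_left h (by positivity)).trans (le_of_eq ?_)
  rw [hA]
  have e2 : ((Lc : ℝ) ^ (i + m + 1)) ^ (2 * (d + 1))
      = (((Lc : ℝ) ^ i) ^ (2 * (d + 1))) * (Lc : ℝ) ^ (2 * (d + 1)) * (((Lc : ℝ) ^ m) ^ (2 * (d + 1))) := by
    rw [← mul_pow, ← mul_pow]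
    congr 1
    ring
  rw [e2]
  field_simp

/-- NOT IN PRINT; OUR BOOKKEEPING ([folklore]).  **THE TENT LETTER, POWER DISPLAYED**: from `hK`, for all `i, m`, components `κ′ μ`, level-`(i+m+1)`-lattice points `u′`
and level-`(i+1)`-lattice points `y`,
`|(Lc^i)^{2(d+1)}·𝒬ᵀ_{Lc^m}[wΦ_{Lc^{i+m+1}}(·, κ′, · − u′)](μ, y)| ≤ C·e^{δ}·((Lc^m)^{2d+1})⁻¹·e^{−δ‖quo (Lc^m) y − u′‖∞}` — `Lc^m` summands of the column letter
(`abs_unitColumn_le`, ℓ¹ weakened to sup by `supNorm_le_l1`) through MY `ContactTentRefine.abs_contourSumAdj_le_centre`. -/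
theorem abs_unitColumnTent_le {C δ : ℝ} (hK : UnitDecayK d Lc (sfStep Lc) (smStep d Lc) C δ) (hδ : 0 ≤ δ) (i m : ℕ) (κ' μ : Fin (d + 1))
    (u' y : Site (d + 1)) :
    |(((Lc : ℝ) ^ i) ^ (2 * (d + 1))) * contourSumAdj (Lc ^ m) (fun κ q => wΦ (N := Lc ^ (i + m + 1)) (d := d) κ κ' (q - u')) μ y|
      ≤ C * Real.exp δ * ((((Lc : ℝ) ^ m) ^ (2 * d + 1))⁻¹) * Real.exp (-(δ * supNorm (quo (Lc ^ m) y - u'))) := by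
  have hL : (0 : ℝ) < (Lc : ℝ) := Nat.cast_pos.2 (Nat.pos_of_ne_zero (NeZero.ne Lc))
  have hC : 0 ≤ C := (hK 0).nonneg (Sum.inl 0)
  rw [← contourSumAdj_const_mul]
  have hφ : ∀ κ q, |(((Lc : ℝ) ^ i) ^ (2 * (d + 1))) * wΦ (N := Lc ^ (i + m + 1)) (d := d) κ κ' (q - u')|
      ≤ C * ((((Lc : ℝ) ^ m) ^ (2 * (d + 1)))⁻¹) * Real.exp (-(δ * supNorm (q - u'))) := by
    intro κ q
    refine (abs_unitColumn_le hK hδ i m κ κ' (q - u')).trans (mul_le_mul_of_nonneg_left ?_ (by positivity))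
    rw [neg_mul]
    exact Real.exp_le_exp.2 (neg_le_neg (mul_le_mul_of_nonneg_left (supNorm_le_l1 _) hδ))
  refine (abs_contourSumAdj_le_centre (N := Lc ^ m) (by positivity) hδ u' hφ μ y).trans (le_of_eq ?_)
  have e : ((Lc : ℝ) ^ m) ^ (2 * (d + 1)) = ((Lc : ℝ) ^ m) ^ (2 * d + 1) * (Lc : ℝ) ^ m := by
    rw [show 2 * (d + 1) = (2 * d + 1) + 1 by ring, pow_succ]
  push_cast
  rw [e]
  field_simp

end Kernel

/-! ## §3 The bracket identities: the dressed chain against a `𝒬ᵀ_{Lc}`-tent of the next unit column -/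

section Bracket

/-- [folklore] A scalar on the coefficient comes out of the bracket (no summability needed). -/
theorem tsum_sum_mul_const_mul (F G : Fin (d + 1) → Site (d + 1) → ℝ) (a : ℝ) :
    ∑' u, ∑ κ, F κ u * (a * G κ u) = a * ∑' u, ∑ κ, F κ u * G κ u := by
  rw [← tsum_mul_left]
  refine tsum_congr fun u => ?_
  rw [Finset.mul_sum]
  exact Finset.sum_congr rfl fun κ _ => by ring

/-- [folklore] The multiplier kernel of one block size is bounded (an2∕an5's `decay_wΦ`; per-`N` constant, only used qualitatively). -/
theorem exists_abs_wΦ_le (N : ℕ) [NeZero N] : ∃ B : ℝ, ∀ (κ l : Fin (d + 1)) (y : Site (d + 1)), |wΦ (N := N) (d := d) κ l y| ≤ B := by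
  obtain ⟨δ, C, hδ, h⟩ := KernelSpecInstance.decay_wΦ (N := N) (d := d)
  refine ⟨max C 0, fun κ l y => (h κ l y).trans ?_⟩
  have he : Real.exp (-δ * l1 y) ≤ 1 := by rw [neg_mul]; exact Real.exp_le_one_iff.2 (neg_nonpos.2 (mul_nonneg hδ.le (l1_nonneg _)))
  calc C * Real.exp (-δ * l1 y) ≤ max C 0 * Real.exp (-δ * l1 y) := mul_le_mul_of_nonneg_right (le_max_left _ _) (Real.exp_pos _).le
    _ ≤ max C 0 := (mul_le_mul_of_nonneg_left he (le_max_right _ _)).trans (mul_one _).le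

/-- [folklore] the sup norm of a difference is symmetric. -/
theorem supNorm_sub_comm (x y : Site (d + 1)) : supNorm (x - y) = supNorm (y - x) := by
  unfold supNorm
  simp only [Pi.sub_apply, abs_sub_comm]

variable {rr : Fin (d + 1) → ℕ}

/-- NOT IN PRINT; OUR BOOKKEEPING ([folklore]).  **ONE STEP (`k = i+1`)**: the dressed one-step response against the born coefficients of its own level
evaluates the unit column: `⟨legChain (respStepBmSeq ρ Lc) i 0 (κ′u′;·), (−cΛ)·((Lc^i)^{2(d+1)}·𝒬ᵀ_{Lc}[wΦ_{Lc^{i+1}}(·;μ;·−y)])⟩ = (−cΛ)·((Lc^i)^{2(d+1)}·wΦ_{Lc^{i+1}} κ′ μ (u′ − y))`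
(the OWNER's `tsum_respStepBmSeq_mul_contourSumAdj`). -/
theorem bracket_eq_of_one_step (hrr : rr ∈ box (d + 1) Lc) (cΛ : ℝ) (i : ℕ) (κ' : Fin (d + 1)) (u' : Site (d + 1)) (μ : Fin (d + 1))
    (y : Site (d + 1)) :
    ∑' u, ∑ κ, legChain (respStepBmSeq (d := d) (toSite rr) Lc) i 0 κ' u' κ u *
        ((-cΛ) * ((((Lc : ℝ) ^ i) ^ (2 * (d + 1))) * contourSumAdj Lc (fun κ'' q => wΦ (N := Lc ^ (i + 1)) (d := d) κ'' μ (q - y)) κ u))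
      = (-cΛ) * ((((Lc : ℝ) ^ i) ^ (2 * (d + 1))) * wΦ (N := Lc ^ (i + 1)) (d := d) κ' μ (u' - y)) := by
  obtain ⟨B, hB⟩ := exists_abs_wΦ_le (d := d) (Lc ^ (i + 1))
  have hφ : ∀ κ q, |wΦ (N := Lc ^ (i + 1)) (d := d) κ μ (q - y)| ≤ B := fun κ q => hB κ μ (q - y)
  rw [tsum_sum_mul_const_mul, legChain_zero,
    tsum_sum_mul_const_mul (fun κ u => respStepBmSeq (d := d) (toSite rr) Lc i κ' u' κ u)
      (fun κ u => contourSumAdj Lc (fun κ'' q => wΦ (N := Lc ^ (i + 1)) (d := d) κ'' μ (q - y)) κ u),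
    tsum_respStepBmSeq_mul_contourSumAdj hrr i hφ κ' u']

/-- NOT IN PRINT; OUR BOOKKEEPING ([folklore]).  **THE CHAIN (`k = i+n+2`) AT `d = 3`** (`2 ≤ Lc`, in-block root; generic `d` = the OWNER's two theorems under his `hψ`):
`⟨legChain (respStepBmSeq ρ Lc) i (n+1) (κ′u′;·), (−cΛ)·((Lc^i)^8·𝒬ᵀ_{Lc}[wΦ_{Lc^{i+1}}(·;μ;·−y)])⟩ = (−cΛ)·((Lc^i)^8·𝒬ᵀ_{Lc^{n+1}}[wΦ_{Lc^{i+n+2}}(·, κ′, · − u′)](μ, y))`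
— the chain climbs one level by adjointness (`tsum_legChain_mul_contourSumAdj`) and the dressing drops out of the vertex slot (`tsum_wΦ_shift_mul_legChain_eq_tent_three`). -/
theorem bracket_eq_tent_of_chain_three {Lc : ℕ} [NeZero Lc] (hLc : 2 ≤ Lc) {rr : Fin (3 + 1) → ℕ} (hrr : rr ∈ box (3 + 1) Lc) (cΛ : ℝ)
    (i n : ℕ) (κ' : Fin (3 + 1)) (u' : Site (3 + 1)) (μ : Fin (3 + 1)) (y : Site (3 + 1)) :
    ∑' u, ∑ κ, legChain (respStepBmSeq (d := 3) (toSite rr) Lc) i (n + 1) κ' u' κ u *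
        ((-cΛ) * ((((Lc : ℝ) ^ i) ^ (2 * (3 + 1))) * contourSumAdj Lc (fun κ'' q => wΦ (N := Lc ^ (i + 1)) (d := 3) κ'' μ (q - y)) κ u))
      = (-cΛ) * ((((Lc : ℝ) ^ i) ^ (2 * (3 + 1))) *
          contourSumAdj (Lc ^ (n + 1)) (fun κ q => wΦ (N := Lc ^ (i + n + 2)) (d := 3) κ κ' (q - u')) μ y) := by
  obtain ⟨B, hB⟩ := exists_abs_wΦ_le (d := 3) (Lc ^ (i + 1))
  have hφ : ∀ κ q, |wΦ (N := Lc ^ (i + 1)) (d := 3) κ μ (q - y)| ≤ B := fun κ q => hB κ μ (q - y)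
  rw [tsum_sum_mul_const_mul,
    tsum_sum_mul_const_mul (fun κ u => legChain (respStepBmSeq (d := 3) (toSite rr) Lc) i (n + 1) κ' u' κ u)
      (fun κ u => contourSumAdj Lc (fun κ'' q => wΦ (N := Lc ^ (i + 1)) (d := 3) κ'' μ (q - y)) κ u),
    tsum_legChain_mul_contourSumAdj hrr i n hφ κ' u', tsum_wΦ_shift_mul_legChain_eq_tent_three hLc hrr i n μ y κ' u']

end Bracket

/-! ## §4 `d = 3`: the (C2) letter, unconditional, power displayed -/

section Three

variable {Lc : ℕ} [NeZero Lc]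

/-- NOT IN PRINT; OUR PROOF ATTEMPT ([folklore] over the K-slot).  **THE (C2) LETTER AT `d = 3` FROM ANY UNIT-DECAY DATA OF THE K-SLOT** (`2 ≤ Lc`; constants
THREADED): `hK = UnitDecayK 3 Lc (sfStep Lc) (smStep 3 Lc) C δ` with `0 < δ` gives, for EVERY in-block root, EVERY `cΛ`, ALL `i, k`, all `κ′ u′ μ y`,
`|⟨T_i(κ′u′;·), (−cΛ)·((Lc^i)^8·𝒬ᵀ_{Lc}[wΦ_{Lc^{i+1}}(·;μ;·−y)])⟩| ≤ |cΛ|·(C·e^{δ})·((Lc^{k−1−i})^7)⁻¹·e^{−δ‖quo (Lc^{k−1−i}) y − u′‖∞}`,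
`T_i = legChain (respStepBmSeq ρ Lc) i (k−1−i)` — one step (`k − 1 − i = 0`: `N′ = 1`, `quo 1 y = y`) and chain (`k − 1 − i = n+1`) alike; the power
`N′^{−(2d+1)} = N′^{−7}`, `N′ = Lc^{k−1−i}` (PRICING-GAN24 v3.16 CHECK #73 ∕ Q18′ (b)). -/
theorem bracket_letter_three_of_unitDecayK (hLc : 2 ≤ Lc) {C δ : ℝ} (hK : UnitDecayK 3 Lc (sfStep Lc) (smStep 3 Lc) C δ) (hδ : 0 < δ)
    {rr : Fin (3 + 1) → ℕ} (hrr : rr ∈ box (3 + 1) Lc) (cΛ : ℝ) (i k : ℕ) (κ' : Fin (3 + 1)) (u' : Site (3 + 1)) (μ : Fin (3 + 1))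
    (y : Site (3 + 1)) :
    |∑' u, ∑ κ, legChain (respStepBmSeq (d := 3) (toSite rr) Lc) i (k - 1 - i) κ' u' κ u *
        ((-cΛ) * ((((Lc : ℝ) ^ i) ^ (2 * (3 + 1))) *
          contourSumAdj Lc (fun κ'' q => wΦ (N := Lc ^ (i + 1)) (d := 3) κ'' μ (q - y)) κ u))|
      ≤ |cΛ| * (C * Real.exp δ) * ((((Lc : ℝ) ^ (k - 1 - i)) ^ (2 * 3 + 1))⁻¹) *
          Real.exp (-(δ * supNorm (quo (Lc ^ (k - 1 - i)) y - u'))) := by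
  have hC : 0 ≤ C := (hK 0).nonneg (Sum.inl 0)
  -- the bracket is `(−cΛ)·X` with `|X| ≤ C·e^{δ}·((Lc^m)^7)⁻¹·e^{−δ‖quo (Lc^m) y − u′‖∞}`, `m = k − 1 − i`, in both cases
  have key : ∀ m : ℕ, ∃ X : ℝ,
      (∑' u, ∑ κ, legChain (respStepBmSeq (d := 3) (toSite rr) Lc) i m κ' u' κ u *
          ((-cΛ) * ((((Lc : ℝ) ^ i) ^ (2 * (3 + 1))) *
            contourSumAdj Lc (fun κ'' q => wΦ (N := Lc ^ (i + 1)) (d := 3) κ'' μ (q - y)) κ u))) = (-cΛ) * X ∧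
        |X| ≤ C * Real.exp δ * ((((Lc : ℝ) ^ m) ^ (2 * 3 + 1))⁻¹) * Real.exp (-(δ * supNorm (quo (Lc ^ m) y - u'))) := by
    intro m
    cases m with
    | zero =>
      refine ⟨(((Lc : ℝ) ^ i) ^ (2 * (3 + 1))) * wΦ (N := Lc ^ (i + 1)) (d := 3) κ' μ (u' - y),
        bracket_eq_of_one_step hrr cΛ i κ' u' μ y, ?_⟩
      have h := abs_unitColumn_le hK hδ.le i 0 κ' μ (u' - y)
      have e : wΦ (N := Lc ^ (i + 0 + 1)) (d := 3) κ' μ (u' - y) = wΦ (N := Lc ^ (i + 1)) (d := 3) κ' μ (u' - y) :=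
        wΦ_congrN (by rw [add_zero]) κ' μ (u' - y)
      rw [e, pow_zero, one_pow, inv_one, mul_one] at h
      rw [pow_zero, pow_zero, one_pow, inv_one, mul_one, quo_one, supNorm_sub_comm]
      refine h.trans ?_
      calc C * Real.exp (-δ * l1 (u' - y)) ≤ C * (Real.exp δ * Real.exp (-(δ * supNorm (u' - y)))) := by
            refine mul_le_mul_of_nonneg_left ?_ hC
            calc Real.exp (-δ * l1 (u' - y)) ≤ Real.exp (-(δ * supNorm (u' - y))) := by
                  rw [neg_mul]
                  exact Real.exp_le_exp.2 (neg_le_neg (mul_le_mul_of_nonneg_left (supNorm_le_l1 _) hδ.le))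
              _ ≤ Real.exp δ * Real.exp (-(δ * supNorm (u' - y))) :=
                  le_mul_of_one_le_left (Real.exp_pos _).le (Real.one_le_exp hδ.le)
        _ = C * Real.exp δ * Real.exp (-(δ * supNorm (u' - y))) := (mul_assoc _ _ _).symm
    | succ n =>
      refine ⟨(((Lc : ℝ) ^ i) ^ (2 * (3 + 1))) *
          contourSumAdj (Lc ^ (n + 1)) (fun κ q => wΦ (N := Lc ^ (i + n + 2)) (d := 3) κ κ' (q - u')) μ y,
        bracket_eq_tent_of_chain_three hLc hrr cΛ i n κ' u' μ y, ?_⟩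
      have e : (fun κ q => wΦ (N := Lc ^ (i + n + 2)) (d := 3) κ κ' (q - u'))
          = fun κ q => wΦ (N := Lc ^ (i + (n + 1) + 1)) (d := 3) κ κ' (q - u') := by
        funext κ q
        exact wΦ_congrN (by rw [show i + n + 2 = i + (n + 1) + 1 by ring]) κ κ' (q - u')
      rw [e]
      exact abs_unitColumnTent_le hK hδ.le i (n + 1) κ' μ u' y
  obtain ⟨X, hX, hb⟩ := key (k - 1 - i)
  rw [hX, abs_mul, abs_neg]
  calc |cΛ| * |X| ≤ |cΛ| * (C * Real.exp δ * ((((Lc : ℝ) ^ (k - 1 - i)) ^ (2 * 3 + 1))⁻¹) *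
        Real.exp (-(δ * supNorm (quo (Lc ^ (k - 1 - i)) y - u')))) := mul_le_mul_of_nonneg_left hb (abs_nonneg _)
    _ = _ := by ring

/-- NOT IN PRINT; OUR PROOF ATTEMPT ([folklore] over the K-slot).  **THE (C2) LETTER OF BORNSEC-PLAN v1 AT `d = 3` (`2 ≤ Lc`), UNCONDITIONAL, POWER DISPLAYED**:
there are `C ≥ 0`, `δ > 0` (road P1's `FibreStrip.unitDecayK_holds`: `C = Cst·e^{2κ₀}·e^{δ}`, `δ = κ₀∕(4Lc)`) such that for EVERY in-block root, EVERY `cΛ`,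
ALL birth ∕ observation levels `i, k`, all `κ′ u′ μ y`:
`|⟨T_i(κ′u′;·), (−cΛ)·((Lc^i)^8·𝒬ᵀ_{Lc}[wΦ_{Lc^{i+1}}(·;μ;·−y)])⟩| ≤ |cΛ|·C·((Lc^{k−1−i})^7)⁻¹·e^{−δ‖quo (Lc^{k−1−i}) y − u′‖∞}`, `T_i = legChain (respStepBmSeq ρ Lc) i (k−1−i)`
— `(k, i)`-UNIFORM constants; the power `N′^{−(2d+1)} = N′^{−7}`, `N′ = Lc^{k−1−i}`. -/
theorem exists_bracket_letter_three (hLc : 2 ≤ Lc) :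
    ∃ C δ : ℝ, 0 ≤ C ∧ 0 < δ ∧ ∀ (rr : Fin (3 + 1) → ℕ), rr ∈ box (3 + 1) Lc → ∀ (cΛ : ℝ) (i k : ℕ),
      ∀ (κ' : Fin (3 + 1)) (u' : Site (3 + 1)) (μ : Fin (3 + 1)) (y : Site (3 + 1)),
        |∑' u, ∑ κ, legChain (respStepBmSeq (d := 3) (toSite rr) Lc) i (k - 1 - i) κ' u' κ u *
            ((-cΛ) * ((((Lc : ℝ) ^ i) ^ (2 * (3 + 1))) *
              contourSumAdj Lc (fun κ'' q => wΦ (N := Lc ^ (i + 1)) (d := 3) κ'' μ (q - y)) κ u))|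
          ≤ |cΛ| * C * ((((Lc : ℝ) ^ (k - 1 - i)) ^ (2 * 3 + 1))⁻¹) * Real.exp (-(δ * supNorm (quo (Lc ^ (k - 1 - i)) y - u'))) := by
  obtain ⟨κ₀, hκ₀, Cst, hK⟩ := unitDecayK_holds (Lc := Lc)
  have hL : (0 : ℝ) < (Lc : ℝ) := Nat.cast_pos.2 (Nat.pos_of_ne_zero (NeZero.ne Lc))
  have hδ : 0 < κ₀ / ((3 + 1) * (Lc : ℝ)) := by positivity
  have hC : 0 ≤ Cst * Real.exp (2 * κ₀) := (hK 0).nonneg (Sum.inl 0)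
  exact ⟨Cst * Real.exp (2 * κ₀) * Real.exp (κ₀ / ((3 + 1) * (Lc : ℝ))), κ₀ / ((3 + 1) * (Lc : ℝ)), by positivity, hδ,
    fun rr hrr cΛ i k κ' u' μ y => bracket_letter_three_of_unitDecayK hLc hK hδ hrr cΛ i k κ' u' μ y⟩

/-- NOT IN PRINT; OUR PROOF ATTEMPT.  **THE (C2) LETTER ON leaf-01's MEMBER-`0` CELLS** (`contact_bornLam_zero_eq_cells_three`'s coefficient `cΛ·lamCoeffOf (KInv Lc) Lc`
LITERALLY; `d = 3`, `2 ≤ Lc`): `|Σ'_u Σ_κ legChain (respStepBmSeq ρ Lc) 0 (k−1−0) κ′ u′ κ u · (cΛ·lamCoeffOf (KInv Lc) Lc μ y κ u)|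
≤ |cΛ|·C·((Lc^{k−1−0})^7)⁻¹·e^{−δ‖quo (Lc^{k−1−0}) y − u′‖∞}` with §4's `(C, δ)` — every `k`, every root. -/
theorem exists_bracket_bornLam_zero_letter_three (hLc : 2 ≤ Lc) :
    ∃ C δ : ℝ, 0 ≤ C ∧ 0 < δ ∧ ∀ (rr : Fin (3 + 1) → ℕ), rr ∈ box (3 + 1) Lc → ∀ (cΛ : ℝ) (k : ℕ),
      ∀ (κ' : Fin (3 + 1)) (u' : Site (3 + 1)) (μ : Fin (3 + 1)) (y : Site (3 + 1)),
        |∑' u, ∑ κ, legChain (respStepBmSeq (d := 3) (toSite rr) Lc) 0 (k - 1 - 0) κ' u' κ u *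
            (cΛ * lamCoeffOf (KInv (N := Lc) (d := 3)) Lc μ y κ u)|
          ≤ |cΛ| * C * ((((Lc : ℝ) ^ (k - 1 - 0)) ^ (2 * 3 + 1))⁻¹) * Real.exp (-(δ * supNorm (quo (Lc ^ (k - 1 - 0)) y - u'))) := by
  obtain ⟨C, δ, hC, hδ, h⟩ := exists_bracket_letter_three (Lc := Lc) hLc
  refine ⟨C, δ, hC, hδ, fun rr hrr cΛ k κ' u' μ y => ?_⟩
  have e : (fun u => ∑ κ, legChain (respStepBmSeq (d := 3) (toSite rr) Lc) 0 (k - 1 - 0) κ' u' κ u *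
        (cΛ * lamCoeffOf (KInv (N := Lc) (d := 3)) Lc μ y κ u))
      = fun u => ∑ κ, legChain (respStepBmSeq (d := 3) (toSite rr) Lc) 0 (k - 1 - 0) κ' u' κ u *
        ((-cΛ) * ((((Lc : ℝ) ^ 0) ^ (2 * (3 + 1))) *
          contourSumAdj Lc (fun κ'' q => wΦ (N := Lc ^ (0 + 1)) (d := 3) κ'' μ (q - y)) κ u)) := by
    funext u
    exact Finset.sum_congr rfl fun κ _ => by rw [bornCoeff_zero_eq_tent]
  rw [e]
  exact h rr hrr cΛ 0 k κ' u' μ y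

/-- NOT IN PRINT; OUR PROOF ATTEMPT.  **THE (C2) LETTER ON leaf-01's MEMBER-`(j+1)` CELLS** (`contact_bornLam_succ_eq_cells_three`'s coefficient
`(cΛ·Lc^8)·lamCoeffK (KStepUnit Lc (j+1)) ((smStep 3 Lc j)²•E2 3 Lc (j+1)) Lc` LITERALLY; `d = 3`, `2 ≤ Lc`): ONE pair `(C, δ)` for ALL `j, k`, all roots:
`|Σ'_u Σ_κ legChain (respStepBmSeq ρ Lc) (j+1) (k−1−(j+1)) κ′ u′ κ u · c_{j+1} μ y κ u| ≤ |cΛ|·C·((Lc^{k−1−(j+1)})^7)⁻¹·e^{−δ‖quo (Lc^{k−1−(j+1)}) y − u′‖∞}`. -/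
theorem exists_bracket_bornLam_succ_letter_three (hLc : 2 ≤ Lc) :
    ∃ C δ : ℝ, 0 ≤ C ∧ 0 < δ ∧ ∀ (rr : Fin (3 + 1) → ℕ), rr ∈ box (3 + 1) Lc → ∀ (cΛ : ℝ) (j k : ℕ),
      ∀ (κ' : Fin (3 + 1)) (u' : Site (3 + 1)) (μ : Fin (3 + 1)) (y : Site (3 + 1)),
        |∑' u, ∑ κ, legChain (respStepBmSeq (d := 3) (toSite rr) Lc) (j + 1) (k - 1 - (j + 1)) κ' u' κ u *
            ((cΛ * (Lc : ℝ) ^ (2 * (3 + 1))) *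
              lamCoeffK (KStepUnit (d := 3) Lc (j + 1)) ((smStep 3 Lc j) ^ 2 • E2 3 Lc (j + 1)) Lc μ y κ u)|
          ≤ |cΛ| * C * ((((Lc : ℝ) ^ (k - 1 - (j + 1))) ^ (2 * 3 + 1))⁻¹) *
            Real.exp (-(δ * supNorm (quo (Lc ^ (k - 1 - (j + 1))) y - u'))) := by
  obtain ⟨C, δ, hC, hδ, h⟩ := exists_bracket_letter_three (Lc := Lc) hLc
  refine ⟨C, δ, hC, hδ, fun rr hrr cΛ j k κ' u' μ y => ?_⟩
  have e : (fun u => ∑ κ, legChain (respStepBmSeq (d := 3) (toSite rr) Lc) (j + 1) (k - 1 - (j + 1)) κ' u' κ u *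
        ((cΛ * (Lc : ℝ) ^ (2 * (3 + 1))) *
          lamCoeffK (KStepUnit (d := 3) Lc (j + 1)) ((smStep 3 Lc j) ^ 2 • E2 3 Lc (j + 1)) Lc μ y κ u))
      = fun u => ∑ κ, legChain (respStepBmSeq (d := 3) (toSite rr) Lc) (j + 1) (k - 1 - (j + 1)) κ' u' κ u *
        ((-cΛ) * ((((Lc : ℝ) ^ (j + 1)) ^ (2 * (3 + 1))) *
          contourSumAdj Lc (fun κ'' q => wΦ (N := Lc ^ (j + 1 + 1)) (d := 3) κ'' μ (q - y)) κ u)) := by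
    funext u
    exact Finset.sum_congr rfl fun κ _ => by rw [bornCoeff_succ_eq_tent]
  rw [e]
  exact h rr hrr cΛ (j + 1) k κ' u' μ y

/-! ## §5 The climbed pairing (the M-Λ ∕ M-V multiplier slot of BOTH halves): the level-`(i+1)` unit column against the dressed chain from level `i+1` -/

/-- NOT IN PRINT; OUR PROOF ATTEMPT ([folklore] over the K-slot).  **THE CLIMBED PAIRING's LETTER** (`d = 3`, `2 ≤ Lc`, in-block root; constants THREADED from any
`hK = UnitDecayK 3 Lc … C δ`, `0 < δ`): for all `i n μ y κ′ u′`,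
`|(Lc^i)^8·Σ'_{y₁} Σ_{κ₁} wΦ_{Lc^{i+1}} κ₁ μ (y₁ − y)·legChain (respStepBmSeq ρ Lc) (i+1) n κ′ u′ κ₁ y₁| ≤ C·e^{δ}·((Lc^{n+1})^7)⁻¹·e^{−δ‖quo (Lc^{n+1}) y − u′‖∞}` — the OWNER's
`tsum_wΦ_shift_mul_legChain_eq_tent_three` (the dressing drops out; the pairing IS the `Lc^{n+1}`-contour tent of the level-`(i+n+2)` column) + §2.  This is the
multiplier-slot factor of BORNSEC-PLAN v1 §0 «THE SAME COUNT FOR V» (M-V: `(wΦ^{(i)}T_{i+1})(μy; z′)` is the same EL tent) as well as the Λ half's bracket after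
the climb — stated on the bare pairing so that either half's cell typist can dock on it whatever the V-sector's comparison object turns out to be. -/
theorem abs_unitColumn_pair_legChain_le_three (hLc : 2 ≤ Lc) {C δ : ℝ} (hK : UnitDecayK 3 Lc (sfStep Lc) (smStep 3 Lc) C δ) (hδ : 0 < δ)
    {rr : Fin (3 + 1) → ℕ} (hrr : rr ∈ box (3 + 1) Lc) (i n : ℕ) (μ : Fin (3 + 1)) (y : Site (3 + 1)) (κ' : Fin (3 + 1)) (u' : Site (3 + 1)) :
    |(((Lc : ℝ) ^ i) ^ (2 * (3 + 1))) * ∑' y₁, ∑ κ₁, wΦ (N := Lc ^ (i + 1)) (d := 3) κ₁ μ (y₁ - y) *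
        legChain (respStepBmSeq (d := 3) (toSite rr) Lc) (i + 1) n κ' u' κ₁ y₁|
      ≤ C * Real.exp δ * ((((Lc : ℝ) ^ (n + 1)) ^ (2 * 3 + 1))⁻¹) * Real.exp (-(δ * supNorm (quo (Lc ^ (n + 1)) y - u'))) := by
  rw [tsum_wΦ_shift_mul_legChain_eq_tent_three hLc hrr i n μ y κ' u']
  have e : (fun κ q => wΦ (N := Lc ^ (i + n + 2)) (d := 3) κ κ' (q - u'))
      = fun κ q => wΦ (N := Lc ^ (i + (n + 1) + 1)) (d := 3) κ κ' (q - u') := by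
    funext κ q
    exact wΦ_congrN (by rw [show i + n + 2 = i + (n + 1) + 1 by ring]) κ κ' (q - u')
  rw [e]
  exact abs_unitColumnTent_le hK hδ.le i (n + 1) κ' μ u' y

/-- NOT IN PRINT; OUR PROOF ATTEMPT.  **THE CLIMBED PAIRING's LETTER, UNCONDITIONAL** (`d = 3`, `2 ≤ Lc`; the same `(C, δ)` as `exists_bracket_letter_three`): `∃ C δ, 0 ≤ C ∧ 0 < δ ∧`
for every in-block root and all `i n μ y κ′ u′`, `|(Lc^i)^8·Σ'_{y₁} Σ_{κ₁} wΦ_{Lc^{i+1}} κ₁ μ (y₁ − y)·legChain (respStepBmSeq ρ Lc) (i+1) n κ′ u′ κ₁ y₁| ≤ C·((Lc^{n+1})^7)⁻¹·e^{−δ‖quo (Lc^{n+1}) y − u′‖∞}`. -/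
theorem exists_unitColumn_pair_legChain_letter_three (hLc : 2 ≤ Lc) :
    ∃ C δ : ℝ, 0 ≤ C ∧ 0 < δ ∧ ∀ (rr : Fin (3 + 1) → ℕ), rr ∈ box (3 + 1) Lc → ∀ (i n : ℕ) (μ : Fin (3 + 1)) (y : Site (3 + 1))
      (κ' : Fin (3 + 1)) (u' : Site (3 + 1)),
        |(((Lc : ℝ) ^ i) ^ (2 * (3 + 1))) * ∑' y₁, ∑ κ₁, wΦ (N := Lc ^ (i + 1)) (d := 3) κ₁ μ (y₁ - y) *
            legChain (respStepBmSeq (d := 3) (toSite rr) Lc) (i + 1) n κ' u' κ₁ y₁|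
          ≤ C * ((((Lc : ℝ) ^ (n + 1)) ^ (2 * 3 + 1))⁻¹) * Real.exp (-(δ * supNorm (quo (Lc ^ (n + 1)) y - u'))) := by
  obtain ⟨κ₀, hκ₀, Cst, hK⟩ := unitDecayK_holds (Lc := Lc)
  have hL : (0 : ℝ) < (Lc : ℝ) := Nat.cast_pos.2 (Nat.pos_of_ne_zero (NeZero.ne Lc))
  have hδ : 0 < κ₀ / ((3 + 1) * (Lc : ℝ)) := by positivity
  have hC : 0 ≤ Cst * Real.exp (2 * κ₀) := (hK 0).nonneg (Sum.inl 0)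
  exact ⟨Cst * Real.exp (2 * κ₀) * Real.exp (κ₀ / ((3 + 1) * (Lc : ℝ))), κ₀ / ((3 + 1) * (Lc : ℝ)), by positivity, hδ,
    fun rr hrr i n μ y κ' u' => abs_unitColumn_pair_legChain_le_three hLc hK hδ hrr i n μ y κ' u'⟩

end Three

end Summit.QuantumFields.BalabanUV.Beta.GAN24.BornLambdaBracketLetter

end
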